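import Mathlib
import Literature.MathematicalPhysics.QuantumFieldTheory.Balaban1983to89.B14Eq16FaddeevPopov
import Literature.MathematicalPhysics.QuantumFieldTheory.Balaban1983to89.B14Sect1Repr

/-!
# `Balaban1983to89.B14Eq16Proof` — T. Bałaban, *Convergent renormalization expansions for lattice gauge theories*, Commun. Math. Phys. **119** (1988) 243–285 [Balaban1988Convergent]: (1.6) p. 247 — the first-step representation `ρ₁(V) = Σ_{P₀P₁} χ₁ᶜ(P₁)χ₁(P₁ᶜ) ∫dU δ(ŪV⁻¹) χ₀ᶜ(P₀)χ₀(P₀ᶜ)χ_{Ax}(P₁¹) exp[…]` — PROVED: `B14.Sect1Repr.Eq16` for the kernel renormalization transformations of [I] (0.13) (model instance), and the same identity in the push-forward reading of `∫dU δ(ŪV⁻¹)` for every gauge-covariant measurable averaging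

statement-level skeleton of published theorems with citation tags; proofs where landed; nothing here is a claim about the Yang–Mills mass gap

PDF held: `paper:balaban1988-cmp119-convergent-renormalization` (journal page = PDF page + 242); (1.5)–(1.7) read on the page render
`…-p005-x2.png` (p. 247) of `run/shared/lean/pub/pub-balaban/b2b-balaban-ref1/pages/1988-cmp119-convergent-renormalization/`, READ AS
AN IMAGE.

WHAT IS REPRODUCED (Phase-2 seat p28, generation 2, of the mega-formalization `lit-balaban`; SKELETON row **B14.Eq1.6**, file 2/2;
decl of record `B14.Sect1Repr.Eq16`, typed by r11 in `…B14Sect1Repr` — "typed, NOT proved" there).  p. 247 [PDF 5], verbatim: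
*"We insert it [(1.5)] under the integral, and we apply the Faddeev-Popov procedure. This yields the equality
  ρ₁(V) = Σ_{P₀P₁} χ₁ᶜ(P₁)χ₁(P₁ᶜ) ∫dU δ(ŪV⁻¹) χ₀ᶜ(P₀)χ₀(P₀ᶜ)χ_{Ax}(P₁¹) · exp[−(1/g₀²) 𝐆(P₁¹, U) − (1/g₀²) A(U) − (L⁴ − 1)|P₁¹| log z − E],   (1.6)
where 𝐆(P₁¹, U) = Σ_{y∈P₁¹} Σ_{x∈B(y), x≠y} [1 − Re tr U(y,x)].   (1.7)"*
PROOF = the printed route: (1.1) inserted (`B14.Sect1Repr.rho0_eq_sum_chi0`) and linearity of the integral; (1.4) inserted at fixed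
`V` (`B14.Sect1Repr.eq14`); the Faddeev–Popov procedure for the partial gauge fixing (1.5) over `y ∈ P₁¹`
(`B14Eq16FaddeevPopov.integral_eq_integral_weight_mul`, file 1/2) and the bookkeeping `B14Eq16FaddeevPopov.weight_eq`
(`Π z⁻¹χe^{…} = χ_{Ax}(P₁¹)·exp[−(1/g₀²)𝐆(P₁¹,U) − (L⁴−1)|P₁¹| log z]`).

THE MODEL INSTANCE (kind «model-instance», PHASE2-TARGETS §G.1).  `Eq16 D T g₀ ε₀ ε₁ z E` quantifies over an ABSTRACT operator
`T : Density P 0 G → Density P 1 G`.  §3 proves it (`eq16`) for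
* `T = B12FaddeevPopov016.KernelRT.T k` — the renormalization transformations of [I] (0.13) `(Tρ)(V) = ∫dU t(V,U)ρ(U)` with a kernel
  invariant under the gauge transformations `u` with `u(y) = 1`, `y ∈ T⁽¹⁾` ([I] p. 254: *"t(V,U) is a gauge invariant kernel … the
  underintegral expression in (0.13) is still invariant with respect to the gauge transformations u satisfying u(y) = 1"*,
  `KernelRT.FineInvariant`) — the class for which [I] prints the Faddeev–Popov argument;
* `z = B16ZLower.zNorm G (g₀²) ε₀` — the `z` DEFINED by (1.5) = (I.0.15) (*"where z is defined by the last integral"*);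
* `d = 4` — the printed exponent `(L⁴ − 1)|P₁¹|` is `Σ_{y∈P₁¹} (|B(y)| − 1)`, `|B(y)| = L^d` (`Site.card_block`);
under the side conditions print leaves implicit (as in the tree's `FP016`): measurability of `U ↦ U(y,x)`, `z ≠ 0`, `g₀ ≠ 0`,
integrability of `t(V,·)ρ₀` for `dU`, and the standing range `1 ≤ m + K` of `Setup.Params`.
§4 (`isRT_eq16`) is (1.6) for the δ-FUNCTION transformation `(Tρ)(V) = ∫dU δ(ŪV⁻¹)ρ(U)` of (0.1) in the cell's push-forward reading
`Setup.IsRT` (the only reading in which `Setup` types it: `∫dV ρ₁(V)f(V) = ∫dU ρ₀(U)f(Ū)` for bounded measurable `f`): if `ρ₁` is the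
renormalization image of `ρ₀` then it is also the renormalization image of the gauge-fixed, decomposed density
`Σ_{P₀P₁} χ₁ᶜ(P₁)(Ū)χ₁(P₁ᶜ)(Ū) · χ₀ᶜ(P₀)χ₀(P₀ᶜ)χ_{Ax}(P₁¹) exp[…]` (the `V`-dependent factors of (1.6) evaluated at `V = Ū`, as the
δ-function dictates) — same route, with `Ū^u = Ū` for `u = 1` at the centres (`avg_gaugeAct_of_fineGauge`); extra side conditions:
`Ū` and the localized background `V ↦ U_{1,□′}(V)` of (1.2) measurable.

Mega-formalization `lit-balaban`, unit `lit-balaban-p28` (gen 2), HOME `run/shared/lean/pub/lit-balaban/`.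

## References
* [Balaban1988Convergent] T. Bałaban, Commun. Math. Phys. 119 (1988) 243–285, (1.5)–(1.7) p. 247.
* [Balaban1987RG1] T. Bałaban, Commun. Math. Phys. 109 (1987) 249–301, (0.13)–(0.16) pp. 254–255.
-/

noncomputable section

open scoped BigOperators
open _root_.MeasureTheory

namespace Literature.MathematicalPhysics.QuantumFieldTheory.Balaban1983to89.B14Eq16Proof

open Literature.MathematicalPhysics.QuantumFieldTheory.Balaban1983to89
open B12FaddeevPopov016 B14Eq16FaddeevPopov B14.Sect1Repr

/-! ## §3. (1.6) PROVED for the kernel renormalization transformations of [I] (0.13) -/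

section Eq16

variable {P : Params} {G : Type*} [GaugeGroup G]

/-- `χ₀(X)` is gauge invariant. [cite: Balaban1988Convergent, (1.1) p.246] -/
theorem chi0_gaugeAct (D : Sect1Data P G) (ε₀ : ℝ) (X : Finset D.Cube0) (u : GaugeTransf P 0 G)
    (U : GaugeField P 0 G) : chi0 D ε₀ X (GaugeField.gaugeAct u U) = chi0 D ε₀ X U := by
  unfold chi0
  exact Finset.prod_congr rfl fun c _ => T4SmallFieldWindowSandwich.chiSmall_gaugeAct _ _ u U

/-- `χ₀ᶜ(X)` is gauge invariant. [cite: Balaban1988Convergent, (1.1) p.246] -/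
theorem chi0c_gaugeAct (D : Sect1Data P G) (ε₀ : ℝ) (X : Finset D.Cube0) (u : GaugeTransf P 0 G)
    (U : GaugeField P 0 G) : chi0c D ε₀ X (GaugeField.gaugeAct u U) = chi0c D ε₀ X U := by
  unfold chi0c
  exact Finset.prod_congr rfl fun c _ => by rw [T4SmallFieldWindowSandwich.chiSmall_gaugeAct _ _ u U]

/-- `ρ₀ = exp[−(1/g₀²)A − E]` is gauge invariant. [cite: Balaban1988Convergent, (0.2) p.244] -/
theorem rho0_gaugeAct (g₀ E : ℝ) (u : GaugeTransf P 0 G) (U : GaugeField P 0 G) :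
    rho0 (P := P) g₀ E (GaugeField.gaugeAct u U) = rho0 g₀ E U := by
  unfold rho0
  rw [wilsonAction4_gaugeAct']

/-- `0 < ρ₀ ≤ e^{−E}` (the Wilson action is `≥ 0`). [cite: Balaban1988Convergent, (0.2) p.244] -/
theorem rho0_pos_le (g₀ E : ℝ) (U : GaugeField P 0 G) :
    0 < rho0 (P := P) g₀ E U ∧ rho0 (P := P) g₀ E U ≤ Real.exp (-E) := by
  unfold rho0
  refine ⟨Real.exp_pos _, Real.exp_le_exp.2 ?_⟩
  have h1 : 0 ≤ (1 / g₀ ^ 2) * wilsonAction4 U := mul_nonneg (by positivity) (wilsonAction4_nonneg U)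
  rw [neg_mul]
  linarith

/-- `0 ≤ χ₀ᶜ(P₀)χ₀(X) ≤ 1`. [cite: Balaban1988Convergent, (1.1) p.246] -/
theorem chi0c_mul_chi0_mem_Icc (D : Sect1Data P G) (ε₀ : ℝ) (P0 X : Finset D.Cube0) (U : GaugeField P 0 G) :
    chi0c D ε₀ P0 U * chi0 D ε₀ X U ∈ Set.Icc (0 : ℝ) 1 := by
  have h0 : ∀ c : D.Cube0, chiSmall (D.plaqT c) ε₀ U ∈ Set.Icc (0 : ℝ) 1 := fun c =>
    ⟨T4ExpWindowSmallField.chiSmall_nonneg _ _ U, T4ExpWindowSmallField.chiSmall_le_one _ _ U⟩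
  have ha : chi0c D ε₀ P0 U ∈ Set.Icc (0 : ℝ) 1 := by
    unfold chi0c
    exact ⟨Finset.prod_nonneg fun c _ => sub_nonneg.2 (h0 c).2,
      Finset.prod_le_one (fun c _ => sub_nonneg.2 (h0 c).2) fun c _ => sub_le_self _ (h0 c).1⟩
  have hb : chi0 D ε₀ X U ∈ Set.Icc (0 : ℝ) 1 := by
    unfold chi0
    exact ⟨Finset.prod_nonneg fun c _ => (h0 c).1, Finset.prod_le_one (fun c _ => (h0 c).1) fun c _ => (h0 c).2⟩
  exact ⟨mul_nonneg ha.1 hb.1, mul_le_one₀ ha.2 hb.1 hb.2⟩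

/-- `0 ≤ χ₁ᶜ(P₁)(V)χ₁(X)(V) ≤ 1`. [cite: Balaban1988Convergent, (1.4) p.246] -/
theorem chi1c_mul_chi1_mem_Icc (D : Sect1Data P G) (ε₁ : ℝ) (P1 X : Finset D.Cube1) (V : GaugeField P 1 G) :
    chi1c D ε₁ P1 V * chi1 D ε₁ X V ∈ Set.Icc (0 : ℝ) 1 := by
  have h0 : ∀ c : D.Cube1, chiSmall (D.plaqT1 c) (ε₁ * ((P.L : ℝ) ^ 2)⁻¹) (U1loc D c V) ∈ Set.Icc (0 : ℝ) 1 :=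
    fun c => ⟨T4ExpWindowSmallField.chiSmall_nonneg _ _ _, T4ExpWindowSmallField.chiSmall_le_one _ _ _⟩
  have ha : chi1c D ε₁ P1 V ∈ Set.Icc (0 : ℝ) 1 := by
    unfold chi1c
    exact ⟨Finset.prod_nonneg fun c _ => sub_nonneg.2 (h0 c).2,
      Finset.prod_le_one (fun c _ => sub_nonneg.2 (h0 c).2) fun c _ => sub_le_self _ (h0 c).1⟩
  have hb : chi1 D ε₁ X V ∈ Set.Icc (0 : ℝ) 1 := by
    unfold chi1
    exact ⟨Finset.prod_nonneg fun c _ => (h0 c).1, Finset.prod_le_one (fun c _ => (h0 c).1) fun c _ => (h0 c).2⟩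
  exact ⟨mul_nonneg ha.1 hb.1, mul_le_one₀ ha.2 hb.1 hb.2⟩

/-- The integrand of (1.6) is the gauge-fixing weight of file 1 times `χ₀ᶜ(P₀)χ₀(P₀ᶜ)ρ₀`, for `Y = P₁¹`, `α = g₀²`, `z > 0`, `d = 4`
(`B14Eq16FaddeevPopov.weight_eq`). [cite: Balaban1988Convergent, (1.6) p.247] -/
theorem weight_mul_eq_integrand16 (hd : P.d = 4) (h01 : 0 + 1 ≤ P.m + P.K) (D : Sect1Data P G)
    {g₀ ε₀ z : ℝ} (hz : 0 < z) (E : ℝ) (P0 : Finset D.Cube0) (P1 : Finset D.Cube1) (U : GaugeField P 0 G) :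
    (∏ y ∈ D.P11 P0 P1, ∏ x ∈ (block y).erase (emb y), z⁻¹ * fpIntegrand (g₀ ^ 2) ε₀ (D.cd.holTo U y x)) *
        (chi0c D ε₀ P0 U * chi0 D ε₀ (Finset.univ \ P0) U * rho0 g₀ E U) =
      integrand16 D g₀ ε₀ z E P0 P1 U := by
  have hsplit : Real.exp (-(1 / g₀ ^ 2) * gaugeFixFn D.cd (D.P11 P0 P1) U - (1 / g₀ ^ 2) * wilsonAction4 U
        - ((P.L : ℝ) ^ 4 - 1) * ((D.P11 P0 P1).card : ℝ) * Real.log z - E) =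
      Real.exp (-(1 / g₀ ^ 2) * gaugeFixFn D.cd (D.P11 P0 P1) U
          - ((P.L : ℝ) ^ 4 - 1) * ((D.P11 P0 P1).card : ℝ) * Real.log z) *
        Real.exp (-(1 / g₀ ^ 2) * wilsonAction4 U - E) := by
    have hring : -(1 / g₀ ^ 2) * gaugeFixFn D.cd (D.P11 P0 P1) U - (1 / g₀ ^ 2) * wilsonAction4 U
          - ((P.L : ℝ) ^ 4 - 1) * ((D.P11 P0 P1).card : ℝ) * Real.log z - E =
        (-(1 / g₀ ^ 2) * gaugeFixFn D.cd (D.P11 P0 P1) U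
            - ((P.L : ℝ) ^ 4 - 1) * ((D.P11 P0 P1).card : ℝ) * Real.log z) +
          (-(1 / g₀ ^ 2) * wilsonAction4 U - E) := by
      ring
    rw [hring, Real.exp_add]
  rw [weight_eq h01 D.cd (g₀ ^ 2) ε₀ hz (D.P11 P0 P1) U, hd]
  unfold integrand16 chiAx rho0
  rw [hsplit]
  ring

variable [MeasurableSpace G]

/-- `U ↦ χ₀ᶜ(P₀)(U)χ₀(X)(U)` is measurable. [cite: Balaban1988Convergent, (1.1) p.246] -/
theorem measurable_chi0c_mul_chi0 [RegularGaugeGroup G] (D : Sect1Data P G) (ε₀ : ℝ) (P0 X : Finset D.Cube0) :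
    Measurable fun U : GaugeField P 0 G => chi0c D ε₀ P0 U * chi0 D ε₀ X U := by
  have ha : Measurable fun U : GaugeField P 0 G => chi0c D ε₀ P0 U := by
    unfold chi0c
    exact Finset.measurable_prod _ fun c _ => measurable_const.sub (T4AxialGaugeFixing.measurable_chiSmall _ _)
  have hb : Measurable fun U : GaugeField P 0 G => chi0 D ε₀ X U := by
    unfold chi0
    exact Finset.measurable_prod _ fun c _ => T4AxialGaugeFixing.measurable_chiSmall _ _
  exact ha.mul hb

/-- `V ↦ χ₁ᶜ(P₁)(V)χ₁(X)(V)` is measurable once the localized background `V ↦ U_{1,□′}(V)` of (1.2) is.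
[cite: Balaban1988Convergent, (1.4) p.246] -/
theorem measurable_chi1c_mul_chi1 [RegularGaugeGroup G] (D : Sect1Data P G) (hU1 : ∀ c, Measurable (U1loc D c))
    (ε₁ : ℝ) (P1 X : Finset D.Cube1) :
    Measurable fun V : GaugeField P 1 G => chi1c D ε₁ P1 V * chi1 D ε₁ X V := by
  have ha : Measurable fun V : GaugeField P 1 G => chi1c D ε₁ P1 V := by
    unfold chi1c
    exact Finset.measurable_prod _ fun c _ =>
      measurable_const.sub ((T4AxialGaugeFixing.measurable_chiSmall _ _).comp (hU1 c))
  have hb : Measurable fun V : GaugeField P 1 G => chi1 D ε₁ X V := by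
    unfold chi1
    exact Finset.measurable_prod _ fun c _ => (T4AxialGaugeFixing.measurable_chiSmall _ _).comp (hU1 c)
  exact ha.mul hb

/-- `ρ₀` is measurable. [cite: Balaban1988Convergent, (0.2) p.244] -/
theorem measurable_rho0 [RegularGaugeGroup G] (g₀ E : ℝ) : Measurable (rho0 (P := P) (G := G) g₀ E) := by
  unfold rho0
  exact Real.measurable_exp.comp
    ((measurable_const.mul (Missing.measurable_wilsonAction4 RegularGaugeGroup.measurable_reTr)).sub measurable_const)

variable [HaarData G] [RegularGaugeGroup G]

/-- **(1.6) PROVED** for the kernel renormalization transformations of [I] (0.13).  Let `T = k.T`,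
`(Tρ)(V) = ∫dU t(V,U)ρ(U)` with `t` invariant under the gauge transformations `u`, `u(y) = 1` for `y ∈ T⁽¹⁾`
(`KernelRT.FineInvariant`), let the contour variables `U ↦ U(y,x)` be measurable, `g₀ ≠ 0`, `z := z(g₀², ε₀) ≠ 0` (the `z`
of (1.5)), `t(V,·)ρ₀` integrable for `dU` for every `V`, `d = 4` and `1 ≤ m + K`.  Then `Eq16 D T g₀ ε₀ ε₁ z E`: for
every `V`, `(Tρ₀)(V) = Σ_{P₀P₁} χ₁ᶜ(P₁)χ₁(P₁ᶜ) (T[χ₀ᶜ(P₀)χ₀(P₀ᶜ)χ_{Ax}(P₁¹) exp[−(1/g₀²)𝐆(P₁¹,U) − (1/g₀²)A(U) −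
(L⁴ − 1)|P₁¹| log z − E]])(V)`.  PROOF = the printed route: (1.1) inserted (`rho0_eq_sum_chi0`) and linearity of the
integral, (1.4) inserted at fixed `V` (`eq14`), the Faddeev–Popov procedure (`integral_eq_integral_weight_mul`) with `Y = P₁¹`
and the bookkeeping `weight_eq`. [cite: Balaban1988Convergent, (1.6) p.247] -/
theorem eq16 (hd : P.d = 4) (h01 : 0 + 1 ≤ P.m + P.K) (D : Sect1Data P G) (k : KernelRT P 0 G)
    (hk : k.FineInvariant)
    (hcd : ∀ (y : Site P 1) (x : Site P 0), Measurable fun U : GaugeField P 0 G => D.cd.holTo U y x)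
    {g₀ ε₀ : ℝ} (hg₀ : g₀ ≠ 0) (hz : B16ZLower.zNorm G (g₀ ^ 2) ε₀ ≠ 0) (ε₁ E : ℝ)
    (hint : ∀ V : GaugeField P 1 G, Integrable (fun U => k.t V U * rho0 g₀ E U) (fieldMeasure P 0 G)) :
    Eq16 D k.T g₀ ε₀ ε₁ (B16ZLower.zNorm G (g₀ ^ 2) ε₀) E := by
  intro V
  have hzpos : 0 < B16ZLower.zNorm G (g₀ ^ 2) ε₀ :=
    lt_of_le_of_ne (B16ZLower.zNorm_nonneg _ _) (Ne.symm hz)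
  have hα : (0 : ℝ) < g₀ ^ 2 := lt_of_le_of_ne (sq_nonneg g₀) (Ne.symm (pow_ne_zero 2 hg₀))
  -- the decomposed density `χ₀ᶜ(P₀)χ₀(P₀ᶜ)ρ₀` and its kernel integrand
  set F0 : Finset D.Cube0 → Density P 0 G := fun P0 U =>
    chi0c D ε₀ P0 U * chi0 D ε₀ (Finset.univ \ P0) U * rho0 g₀ E U with hF0
  have hF0_int : ∀ P0 : Finset D.Cube0, Integrable (fun U => k.t V U * F0 P0 U) (fieldMeasure P 0 G) := by
    intro P0
    have hbdd : ∀ U : GaugeField P 0 G, ‖chi0c D ε₀ P0 U * chi0 D ε₀ (Finset.univ \ P0) U‖ ≤ 1 := by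
      intro U
      rw [Real.norm_eq_abs, abs_of_nonneg (chi0c_mul_chi0_mem_Icc D ε₀ P0 _ U).1]
      exact (chi0c_mul_chi0_mem_Icc D ε₀ P0 _ U).2
    have h := (hint V).bdd_mul (measurable_chi0c_mul_chi0 D ε₀ P0 (Finset.univ \ P0)).aestronglyMeasurable
      (Filter.Eventually.of_forall hbdd)
    refine h.congr (Filter.Eventually.of_forall fun U => ?_)
    simp only [hF0]
    ring
  have hF0_inv : ∀ P0 : Finset D.Cube0, FineGaugeInvariant (fun U => k.t V U * F0 P0 U) := by
    intro P0 u hu U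
    simp only [hF0]
    rw [hk u hu V U, chi0c_gaugeAct, chi0_gaugeAct, rho0_gaugeAct]
  -- Step 1: (1.1) inserted and linearity: `(Tρ₀)(V) = Σ_{P₀} (T[χ₀ᶜχ₀ρ₀])(V)`.
  have h1 : k.T (rho0 g₀ E) V = ∑ P0 ∈ (Finset.univ : Finset D.Cube0).powerset, k.T (F0 P0) V := by
    unfold KernelRT.T
    rw [← integral_finsetSum _ (fun P0 _ => hF0_int P0)]
    refine integral_congr_ae (Filter.Eventually.of_forall fun U => ?_)
    simp only [hF0]
    rw [← Finset.mul_sum, ← rho0_eq_sum_chi0 D g₀ ε₀ E U]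
  -- Step 2: the Faddeev–Popov procedure and the bookkeeping, for each `P₀`, `P₁`.
  have h2 : ∀ (P0 : Finset D.Cube0) (P1 : Finset D.Cube1),
      k.T (F0 P0) V = k.T (integrand16 D g₀ ε₀ (B16ZLower.zNorm G (g₀ ^ 2) ε₀) E P0 P1) V := by
    intro P0 P1
    unfold KernelRT.T
    rw [integral_eq_integral_weight_mul h01 D.cd hcd hα hz (D.P11 P0 P1) (hF0_inv P0) (hF0_int P0)]
    refine integral_congr_ae (Filter.Eventually.of_forall fun U => ?_)
    simp only [hF0]
    rw [← weight_mul_eq_integrand16 hd h01 D hzpos E P0 P1 U]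
    ring
  -- Step 3: (1.4) inserted at fixed `V`, and assembly.
  rw [h1]
  unfold rho1Rhs
  refine Finset.sum_congr rfl fun P0 _ => ?_
  have h14 : ∑ P1 ∈ (D.inCompl P0).powerset, chi1c D ε₁ P1 V * chi1 D ε₁ (D.inCompl P0 \ P1) V = 1 :=
    calc ∑ P1 ∈ (D.inCompl P0).powerset, chi1c D ε₁ P1 V * chi1 D ε₁ (D.inCompl P0 \ P1) V
        = ∑ P1 ∈ (D.inCompl P0).powerset, chi1 D ε₁ (D.inCompl P0 \ P1) V * chi1c D ε₁ P1 V :=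
          Finset.sum_congr rfl fun P1 _ => mul_comm _ _
      _ = 1 := eq14 D ε₁ P0 V
  calc k.T (F0 P0) V
      = (∑ P1 ∈ (D.inCompl P0).powerset, chi1c D ε₁ P1 V * chi1 D ε₁ (D.inCompl P0 \ P1) V) * k.T (F0 P0) V := by
        rw [h14, one_mul]
    _ = ∑ P1 ∈ (D.inCompl P0).powerset, chi1c D ε₁ P1 V * chi1 D ε₁ (D.inCompl P0 \ P1) V *
          k.T (integrand16 D g₀ ε₀ (B16ZLower.zNorm G (g₀ ^ 2) ε₀) E P0 P1) V := by
        rw [Finset.sum_mul]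
        exact Finset.sum_congr rfl fun P1 _ => by rw [h2 P0 P1]

end Eq16

/-! ## §4. (1.6) in the push-forward reading of the δ-function transformation `∫dU δ(ŪV⁻¹)` of (0.1) -/

section PushForward

variable {P : Params} {G : Type*} [GaugeGroup G] [MeasurableSpace G] [HaarData G] [RegularGaugeGroup G]

/-- **(1.6) for the δ-function transformation of (0.1), push-forward reading.**  Let `Ū = av.avg U` be a gauge-covariant
averaging (`Setup.Averaging`) with `Ū` measurable, let the localized background `V ↦ U_{1,□′}(V)` of (1.2) and the contour
variables `U ↦ U(y,x)` be measurable, `g₀ ≠ 0`, `z := z(g₀², ε₀) ≠ 0`, `d = 4`, `1 ≤ m + K`.  If `ρ₁` is the renormalization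
image of `ρ₀` — `∫dV ρ₁(V)f(V) = ∫dU ρ₀(U)f(Ū)` for all bounded measurable `f` (`Setup.IsRT`, the cell's reading of
`ρ₁(V) = ∫dU δ(ŪV⁻¹)ρ₀(U)`) — then `ρ₁` is also the renormalization image of the gauge-fixed, decomposed density of (1.6),
`U ↦ Σ_{P₀P₁} χ₁ᶜ(P₁)(Ū)χ₁(P₁ᶜ)(Ū) · χ₀ᶜ(P₀)χ₀(P₀ᶜ)χ_{Ax}(P₁¹) exp[−(1/g₀²)𝐆(P₁¹,U) − (1/g₀²)A(U) − (L⁴ − 1)|P₁¹| log z − E]`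
(the `V`-dependent factors of (1.6) evaluated at `V = Ū`, as `δ(ŪV⁻¹)` dictates).  PROOF = the printed route under `∫dU f(Ū)·`:
(1.1), (1.4) at `Ū`, the Faddeev–Popov procedure (`integral_eq_integral_weight_mul`; `Ū^u = Ū`, `avg_gaugeAct_of_fineGauge`),
`weight_eq`. [cite: Balaban1988Convergent, (1.6) p.247] -/
theorem isRT_eq16 (hd : P.d = 4) (h01 : 0 + 1 ≤ P.m + P.K) (D : Sect1Data P G) (av : Averaging P 0 G)
    (hav : Measurable av.avg) (hU1 : ∀ c, Measurable (U1loc D c))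
    (hcd : ∀ (y : Site P 1) (x : Site P 0), Measurable fun U : GaugeField P 0 G => D.cd.holTo U y x)
    {g₀ ε₀ : ℝ} (hg₀ : g₀ ≠ 0) (hz : B16ZLower.zNorm G (g₀ ^ 2) ε₀ ≠ 0) (ε₁ E : ℝ)
    {ρ₁ : Density P 1 G} (hρ₁ : IsRT av.avg (rho0 g₀ E) ρ₁) :
    IsRT av.avg (fun U => ∑ P0 ∈ (Finset.univ : Finset D.Cube0).powerset, ∑ P1 ∈ (D.inCompl P0).powerset,
      chi1c D ε₁ P1 (av.avg U) * chi1 D ε₁ (D.inCompl P0 \ P1) (av.avg U) *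
        integrand16 D g₀ ε₀ (B16ZLower.zNorm G (g₀ ^ 2) ε₀) E P0 P1 U) ρ₁ := by
  intro f hf hfb
  obtain ⟨C, hC⟩ := hfb
  rw [hρ₁ f hf ⟨C, hC⟩]
  have hzpos : 0 < B16ZLower.zNorm G (g₀ ^ 2) ε₀ :=
    lt_of_le_of_ne (B16ZLower.zNorm_nonneg _ _) (Ne.symm hz)
  have hα : (0 : ℝ) < g₀ ^ 2 := lt_of_le_of_ne (sq_nonneg g₀) (Ne.symm (pow_ne_zero 2 hg₀))
  -- abbreviations: the decomposed density `A P₀ = χ₀ᶜ(P₀)χ₀(P₀ᶜ)ρ₀` and the coefficients `c P₀ P₁ = χ₁ᶜ(P₁)(Ū)χ₁(P₁ᶜ)(Ū)`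
  set A : Finset D.Cube0 → Density P 0 G := fun P0 U =>
    chi0c D ε₀ P0 U * chi0 D ε₀ (Finset.univ \ P0) U * rho0 g₀ E U with hA
  set c : Finset D.Cube0 → Finset D.Cube1 → Density P 0 G := fun P0 P1 U =>
    chi1c D ε₁ P1 (av.avg U) * chi1 D ε₁ (D.inCompl P0 \ P1) (av.avg U) with hc
  -- measurability and bounds
  have hfav : Measurable fun U : GaugeField P 0 G => f (av.avg U) := hf.comp hav
  have hA_meas : ∀ P0, Measurable (A P0) := fun P0 =>
    (measurable_chi0c_mul_chi0 D ε₀ P0 (Finset.univ \ P0)).mul (measurable_rho0 g₀ E)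
  have hA_bdd : ∀ P0 U, |A P0 U| ≤ Real.exp (-E) := by
    intro P0 U
    simp only [hA]
    have h1 := chi0c_mul_chi0_mem_Icc D ε₀ P0 (Finset.univ \ P0) U
    have h2 := rho0_pos_le (P := P) g₀ E U
    rw [abs_of_nonneg (mul_nonneg h1.1 h2.1.le)]
    calc chi0c D ε₀ P0 U * chi0 D ε₀ (Finset.univ \ P0) U * rho0 g₀ E U
        ≤ 1 * rho0 g₀ E U := mul_le_mul_of_nonneg_right h1.2 h2.1.le
      _ ≤ Real.exp (-E) := by rw [one_mul]; exact h2.2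
  have hc_meas : ∀ P0 P1, Measurable (c P0 P1) := fun P0 P1 =>
    (measurable_chi1c_mul_chi1 D hU1 ε₁ P1 (D.inCompl P0 \ P1)).comp hav
  have hc_bdd : ∀ P0 P1 U, ‖c P0 P1 U‖ ≤ 1 := by
    intro P0 P1 U
    simp only [hc]
    have h := chi1c_mul_chi1_mem_Icc D ε₁ P1 (D.inCompl P0 \ P1) (av.avg U)
    rw [Real.norm_eq_abs, abs_of_nonneg h.1]
    exact h.2
  -- integrability of the pieces (bounded measurable functions on a probability space)
  have hI1 : ∀ P0, Integrable (fun U => A P0 U * f (av.avg U)) (fieldMeasure P 0 G) := by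
    intro P0
    refine AveragingRT.integrable_of_abs_le ((hA_meas P0).mul hfav) (Real.exp (-E) * |C|) fun U => ?_
    rw [abs_mul]
    exact mul_le_mul (hA_bdd P0 U) ((hC _).trans (le_abs_self C)) (abs_nonneg _) (Real.exp_nonneg _)
  have hI2 : ∀ P0 P1, Integrable (fun U => c P0 P1 U * (A P0 U * f (av.avg U))) (fieldMeasure P 0 G) := by
    intro P0 P1
    exact (hI1 P0).bdd_mul (hc_meas P0 P1).aestronglyMeasurable (Filter.Eventually.of_forall (hc_bdd P0 P1))
  -- fine-gauge invariance of the Faddeev–Popov integrands (`Ū^u = Ū`)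
  have hinv : ∀ P0 P1, FineGaugeInvariant (fun U => c P0 P1 U * (A P0 U * f (av.avg U))) := by
    intro P0 P1 u hu U
    simp only [hc, hA]
    rw [avg_gaugeAct_of_fineGauge h01 av hu U, chi0c_gaugeAct, chi0_gaugeAct, rho0_gaugeAct]
  -- the Faddeev–Popov procedure for each `P₀`, `P₁`
  have hFP : ∀ P0 P1, ∫ U, c P0 P1 U * (A P0 U * f (av.avg U)) ∂(fieldMeasure P 0 G) =
      ∫ U, c P0 P1 U * integrand16 D g₀ ε₀ (B16ZLower.zNorm G (g₀ ^ 2) ε₀) E P0 P1 U * f (av.avg U)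
        ∂(fieldMeasure P 0 G) := by
    intro P0 P1
    rw [integral_eq_integral_weight_mul h01 D.cd hcd hα hz (D.P11 P0 P1) (hinv P0 P1) (hI2 P0 P1)]
    refine integral_congr_ae (Filter.Eventually.of_forall fun U => ?_)
    simp only [hA]
    rw [← weight_mul_eq_integrand16 hd h01 D hzpos E P0 P1 U]
    ring
  -- integrability of the gauge-fixed pieces (for pulling the finite sums out of the integral)
  have hI3 : ∀ P0 P1, Integrable (fun U => c P0 P1 U *
      integrand16 D g₀ ε₀ (B16ZLower.zNorm G (g₀ ^ 2) ε₀) E P0 P1 U * f (av.avg U)) (fieldMeasure P 0 G) := by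
    intro P0 P1
    have h := integrable_weight_mul (fieldMeasure P 0 G) D.cd hcd hα ε₀ (B16ZLower.zNorm G (g₀ ^ 2) ε₀)
      (D.P11 P0 P1) (hI2 P0 P1)
    refine h.congr (Filter.Eventually.of_forall fun U => ?_)
    simp only [hA]
    rw [← weight_mul_eq_integrand16 hd h01 D hzpos E P0 P1 U]
    ring
  -- assembly
  calc ∫ U, rho0 g₀ E U * f (av.avg U) ∂(fieldMeasure P 0 G)
      = ∫ U, ∑ P0 ∈ (Finset.univ : Finset D.Cube0).powerset, A P0 U * f (av.avg U) ∂(fieldMeasure P 0 G) := by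
        refine integral_congr_ae (Filter.Eventually.of_forall fun U => ?_)
        simp only [hA]
        rw [← Finset.sum_mul, ← rho0_eq_sum_chi0 D g₀ ε₀ E U]
    _ = ∑ P0 ∈ (Finset.univ : Finset D.Cube0).powerset, ∫ U, A P0 U * f (av.avg U) ∂(fieldMeasure P 0 G) :=
        integral_finsetSum _ (fun P0 _ => hI1 P0)
    _ = ∑ P0 ∈ (Finset.univ : Finset D.Cube0).powerset, ∑ P1 ∈ (D.inCompl P0).powerset,
          ∫ U, c P0 P1 U * integrand16 D g₀ ε₀ (B16ZLower.zNorm G (g₀ ^ 2) ε₀) E P0 P1 U * f (av.avg U)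
            ∂(fieldMeasure P 0 G) := by
        refine Finset.sum_congr rfl fun P0 _ => ?_
        have h14 : ∀ U : GaugeField P 0 G, ∑ P1 ∈ (D.inCompl P0).powerset, c P0 P1 U = 1 := by
          intro U
          simp only [hc]
          calc ∑ P1 ∈ (D.inCompl P0).powerset,
                chi1c D ε₁ P1 (av.avg U) * chi1 D ε₁ (D.inCompl P0 \ P1) (av.avg U)
              = ∑ P1 ∈ (D.inCompl P0).powerset,
                  chi1 D ε₁ (D.inCompl P0 \ P1) (av.avg U) * chi1c D ε₁ P1 (av.avg U) :=
                Finset.sum_congr rfl fun P1 _ => mul_comm _ _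
            _ = 1 := eq14 D ε₁ P0 (av.avg U)
        calc ∫ U, A P0 U * f (av.avg U) ∂(fieldMeasure P 0 G)
            = ∫ U, ∑ P1 ∈ (D.inCompl P0).powerset, c P0 P1 U * (A P0 U * f (av.avg U)) ∂(fieldMeasure P 0 G) := by
              refine integral_congr_ae (Filter.Eventually.of_forall fun U => ?_)
              beta_reduce
              rw [← Finset.sum_mul, h14 U, one_mul]
          _ = ∑ P1 ∈ (D.inCompl P0).powerset, ∫ U, c P0 P1 U * (A P0 U * f (av.avg U)) ∂(fieldMeasure P 0 G) :=
              integral_finsetSum _ (fun P1 _ => hI2 P0 P1)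
          _ = ∑ P1 ∈ (D.inCompl P0).powerset,
                ∫ U, c P0 P1 U * integrand16 D g₀ ε₀ (B16ZLower.zNorm G (g₀ ^ 2) ε₀) E P0 P1 U * f (av.avg U)
                  ∂(fieldMeasure P 0 G) :=
              Finset.sum_congr rfl fun P1 _ => hFP P0 P1
    _ = ∫ U, (∑ P0 ∈ (Finset.univ : Finset D.Cube0).powerset, ∑ P1 ∈ (D.inCompl P0).powerset,
          c P0 P1 U * integrand16 D g₀ ε₀ (B16ZLower.zNorm G (g₀ ^ 2) ε₀) E P0 P1 U) * f (av.avg U)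
            ∂(fieldMeasure P 0 G) := by
        symm
        calc ∫ U, (∑ P0 ∈ (Finset.univ : Finset D.Cube0).powerset, ∑ P1 ∈ (D.inCompl P0).powerset,
              c P0 P1 U * integrand16 D g₀ ε₀ (B16ZLower.zNorm G (g₀ ^ 2) ε₀) E P0 P1 U) * f (av.avg U)
                ∂(fieldMeasure P 0 G)
            = ∫ U, ∑ P0 ∈ (Finset.univ : Finset D.Cube0).powerset, ∑ P1 ∈ (D.inCompl P0).powerset,
                c P0 P1 U * integrand16 D g₀ ε₀ (B16ZLower.zNorm G (g₀ ^ 2) ε₀) E P0 P1 U * f (av.avg U)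
                  ∂(fieldMeasure P 0 G) := by
              refine integral_congr_ae (Filter.Eventually.of_forall fun U => ?_)
              simp_rw [Finset.sum_mul]
          _ = ∑ P0 ∈ (Finset.univ : Finset D.Cube0).powerset, ∫ U, ∑ P1 ∈ (D.inCompl P0).powerset,
                c P0 P1 U * integrand16 D g₀ ε₀ (B16ZLower.zNorm G (g₀ ^ 2) ε₀) E P0 P1 U * f (av.avg U)
                  ∂(fieldMeasure P 0 G) :=
              integral_finsetSum _ (fun P0 _ => integrable_finsetSum _ (fun P1 _ => hI3 P0 P1))
          _ = _ := Finset.sum_congr rfl fun P0 _ => integral_finsetSum _ (fun P1 _ => hI3 P0 P1)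

end PushForward

end Literature.MathematicalPhysics.QuantumFieldTheory.Balaban1983to89.B14Eq16Proof

end
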